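import Literature.RepresentationTheory.MoeglinVignerasWaldspurger1987.RankOneThetaLiftLinesEquivalent
import Literature.RepresentationTheory.HeisenbergGroup.SchrodingerPiGeneration
import Literature.NumberTheory.GelbartRogawski1991.RationalSymplecticUnramifiedVector
import Literature.NumberTheory.GelbartRogawski1991.LocalLineModelTransport
import Literature.NumberTheory.Automorphic.QuadraticLocalNormWitnessFamily
import HarnessLib

/-!
# The local line-transport operators `M_{x_v}` fix the unramified vector `1_{𝒪_vᴺ}` at almost every place

Topic `NumberTheory/GelbartRogawski1991`; namespace `Literature.NumberTheory.GelbartRogawski1991.UnitaryDualPair.LocalSplitting`.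
THEOREMS ONLY (no definition, no named fact, no instance, no `sorry`).  Cell `hodgecm-mathlib`, FLOOR-0 P4, brick (C2) = (P′3)
of the line-class transport `lineClassTransport_equiv` (road (C) of the S4a lead: local COINVARIANT equivalences glued by
★ `IsRestrictedTensorProductRep.exists_equiv_of_forall_equiv`, whose gluing hypothesis is «base vectors matched up to units a.e.»).

SETTING ([MoeglinVignerasWaldspurger1987] Chap. 2 II.1, II.10, Chap. 3 I.1–I.3; [Weil1964] Chap. III n° 37–38; [GelbartRogawski1991]
§3.1 (3.1.3) p. 456).  `E/F` quadratic with `c`, trace-zero `δ₁, δ₂` (`δᵢ² = dᵢ ∈ F`), a symmetric `T ∈ GL_N(F)`, a finite place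
`v`, a unit `x ∈ (E ⊗_F F_v)^×` with `δ₂ ⊗ 1 = x x̄ (δ₁ ⊗ 1)`; ★ `RankOneThetaLiftLinesEquivalent` attaches to `x` the symplectic
transport `γ_x = reIm_{δ₂} ∘ (u ↦ x u) ∘ reIm_{δ₁}⁻¹ ∈ Sp(𝕎_v)`, a CHOSEN metaplectic lift `q_x = (γ_x, M_x)` and the operator
`M_x = lineTransportOp` of `𝒮(F_vᴺ)` intertwining the Weil representations of the two lines.
* §1 **`exists_smul_unitVec_of_implements_of_darbouxMatrix_mem`** — at a place with `2 ∈ 𝒪_v^×` and `ψ_v` of conductor `𝒪_v`,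
  every implementer on `𝒮(F_vᴺ)` of a `γ ∈ Sp(𝕎_v)` whose matrix in the Darboux coordinates `(a, b) ↦ (a, 𝕋_v b)` is `v`-integral
  maps `1_{𝒪_vᴺ}` into `ℂˣ 1_{𝒪_vᴺ}` (lift to `Sp_{2N}(𝒪_v)`, `exists_mapHom_subtype_eq`, + ★ `exists_smul_integersIndicator_of_implements`
  + ★ `implementerUniqueUpToScalar_localSchrodinger`).
* §2 **`transport_apply_of_coords`** — for `x = ι_v p + ι_v q · δ₁`, `δ₁ ⊗ 1 = ι_v s · (δ₂ ⊗ 1)`: `γ_x (a, b) = (p a + d₁ q b,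
  s (q a + p b))`, so its Darboux matrix `(p, d₁ q 𝕋_v⁻¹; s q 𝕋_v, s p)` is `v`-integral when `p, q, d₁, s, 𝕋_v, 𝕋_v⁻¹` are
  (`darbouxMatrix_transport_mem`); **`exists_smul_unitVec_lineTransportOp`**: then `M_x 1_{𝒪_vᴺ} ∈ ℂˣ 1_{𝒪_vᴺ}`.
* §3 **`exists_localRing_units_lineDelta_eventually_smul_unitVec`** (the `hx` currency of ★ S6a / ★ (P′1)
  `exists_localRing_units_lineDelta_eq`) — for lines `a₁, a₂ ∈ F^×` of the same local norm class at every finite place there are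
  units `x_v` with `a₂⁻¹δ = x_v x̄_v a₁⁻¹δ` at EVERY `v` and `M_{x_v} 1_{𝒪_vᴺ} ∈ ℂˣ 1_{𝒪_vᴺ}` at ALMOST EVERY `v` (the coordinates of
  `x_v` are finite adèles of constant norm `a₂⁻¹a₁`, `s = a₁⁻¹a₂` is a global unit, `T` is rational, `2`/`ψ_v` good a.e.).

HC_CM is proved only modulo the 7 printed citations until rung 0 closes; this file proves nothing about them.

## References
* [MoeglinVignerasWaldspurger1987] C. Mœglin, M.-F. Vignéras, J.-L. Waldspurger, *Correspondances de Howe sur un corps p-adique*,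
  LNM 1291 (1987) — Chap. 2 II.1 (A)–(B), II.10; Chap. 3 I.1–I.3.
* [Weil1964] A. Weil, *Sur certains groupes d'opérateurs unitaires*, Acta Math. 111 (1964) — Chap. III n° 37–38, p. 188–190.
* [GelbartRogawski1991] S. Gelbart, J. Rogawski, Invent. Math. 105 (1991) — §3.1 (3.1.3), p. 456.
* [CasselsFrohlichANT1967] J. W. S. Cassels, A. Fröhlich (eds.), *Algebraic Number Theory* (1967) — Ch. II §§10–11, §14.
* [Omeara1963] O. T. O'Meara, *Introduction to quadratic forms* (1963) — §65A.
-/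

set_option autoImplicit false

noncomputable section

open scoped Matrix Classical
open NumberField IsDedekindDomain Filter MeasureTheory
open Literature.RepresentationTheory.HeisenbergGroup
open Literature.RepresentationTheory.MoeglinVignerasWaldspurger1987
open Literature.NumberTheory.Automorphic Literature.NumberTheory.Automorphic.UnitaryGroup

namespace Literature.NumberTheory.GelbartRogawski1991.UnitaryDualPair.LocalSplitting

/-! ## §1 Implementers of Darboux-integral symplectic elements fix the line of `1_{𝒪_vᴺ}` -/

section Generic

variable (F : Type) [Field F] [NumberField F] (N : ℕ) (T : Matrix (Fin N) (Fin N) F) (hTd : IsUnit T.det)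
  (v : HeightOneSpectrum (𝓞 F))

/-- `A u` is `v`-integral when the matrix `A` and the vector `u` are. [cite: CasselsFrohlichANT1967, Ch. II §14] -/
theorem mulVec_mem_adicCompletionIntegers {m n : Type*} [Fintype n] (A : Matrix m n (v.adicCompletion F))
    (hA : ∀ i j, A i j ∈ v.adicCompletionIntegers F) (u : n → v.adicCompletion F)
    (hu : ∀ j, u j ∈ v.adicCompletionIntegers F) (i : m) : (A *ᵥ u) i ∈ v.adicCompletionIntegers F := by
  simp only [Matrix.mulVec, dotProduct]
  exact sum_mem fun j _ => mul_mem (hA i j) (hu j)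

/-- **a `v`-integral symplectic matrix over `F_v` is the image of a symplectic matrix over `𝒪_v`** (the symplectic identity is
checked after the injective entrywise map `𝒪_v → F_v`). [cite: Weil1964, Chap. III n° 37 p. 188] -/
theorem exists_mapHom_subtype_eq (B : Matrix.symplecticGroup (Fin N) (v.adicCompletion F))
    (hB : ∀ i j, (B : Matrix (Fin N ⊕ Fin N) (Fin N ⊕ Fin N) (v.adicCompletion F)) i j ∈ v.adicCompletionIntegers F) :
    ∃ A : Matrix.symplecticGroup (Fin N) ↥(v.adicCompletionIntegers F),
      SymplecticMatrix.mapHom (v.adicCompletionIntegers F).subtype A = B := by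
  have hinj : Function.Injective fun A : Matrix (Fin N ⊕ Fin N) (Fin N ⊕ Fin N) ↥(v.adicCompletionIntegers F) =>
      A.map (v.adicCompletionIntegers F).subtype :=
    fun A A' h => Matrix.ext fun i j => Subtype.ext (congrFun (congrFun h i) j)
  have hA : (Matrix.of fun i j => (⟨_, hB i j⟩ : ↥(v.adicCompletionIntegers F))).map (v.adicCompletionIntegers F).subtype =
      (B : Matrix (Fin N ⊕ Fin N) (Fin N ⊕ Fin N) (v.adicCompletion F)) := rfl
  refine ⟨⟨Matrix.of fun i j => ⟨_, hB i j⟩, ?_⟩, Subtype.ext (by rw [SymplecticMatrix.coe_mapHom]; exact hA)⟩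
  rw [SymplecticGroup.mem_iff]
  apply hinj
  change ((Matrix.of fun i j => (⟨_, hB i j⟩ : ↥(v.adicCompletionIntegers F))) * Matrix.J (Fin N) ↥(v.adicCompletionIntegers F) *
      (Matrix.of fun i j => (⟨_, hB i j⟩ : ↥(v.adicCompletionIntegers F)))ᵀ).map (v.adicCompletionIntegers F).subtype =
    (Matrix.J (Fin N) ↥(v.adicCompletionIntegers F)).map (v.adicCompletionIntegers F).subtype
  rw [Matrix.map_mul, Matrix.map_mul, Matrix.transpose_map, Matrix.map_J _ (v.adicCompletionIntegers F).subtype, hA]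
  exact SymplecticGroup.mem_iff.1 B.2

/-- **`γ = transportSp 𝕋_v (darbouxMatrix γ)`**: every `γ ∈ Sp(𝕎_v)` is the transport of its own Darboux matrix (the preimage
exhibited by ★ `transportSp_surjective`). [cite: Weil1964, Chap. I n° 5 p. 150] -/
theorem transportSp_darbouxMatrix (γ : LocalSp F N T v) :
    SymplecticMatrix.transportSp (localGram F N T v) (isUnit_det_localGram F N T hTd v)
        ⟨darbouxMatrix (localGram F N T v) (isUnit_det_localGram F N T hTd v) γ.1,
          darbouxMatrix_mem_symplecticGroup (localGram F N T v) (isUnit_det_localGram F N T hTd v) γ⟩ = γ := by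
  apply Subtype.ext
  apply LinearEquiv.ext
  intro w
  rw [SymplecticMatrix.coe_transportSp_apply]
  change (SymplecticMatrix.darboux (localGram F N T v) (isUnit_det_localGram F N T hTd v)).symm
      (darbouxMatrix (localGram F N T v) (isUnit_det_localGram F N T hTd v) _ *ᵥ
        SymplecticMatrix.darboux (localGram F N T v) (isUnit_det_localGram F N T hTd v) w) = _
  rw [darbouxMatrix_mulVec, LinearEquiv.symm_apply_apply, LinearEquiv.symm_apply_apply]

/-- **IMPLEMENTERS OF DARBOUX-INTEGRAL SYMPLECTIC ELEMENTS HAVE `1_{𝒪_vᴺ}` AS AN EIGENVECTOR**: at a finite place `v` with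
`2 ∈ 𝒪_v^×` and `ψ_v` of conductor `𝒪_v`, if the matrix of `γ ∈ Sp(𝕎_v)` in the Darboux coordinates `(a, b) ↦ (a, 𝕋_v b)` is
`v`-integral, every `M` implementing `γ` on `𝒮(F_vᴺ)` (model `localSchrodinger F N T v`) has `M 1_{𝒪_vᴺ} = c · 1_{𝒪_vᴺ}`, `c ∈ ℂˣ`
(★ `exists_smul_integersIndicator_of_implements` for the lift to `Sp_{2N}(𝒪_v)`, ★ `implementerUniqueUpToScalar_localSchrodinger`).
[cite: MoeglinVignerasWaldspurger1987, Chap. 2 II.10] [cite: Weil1964, Chap. III n° 38 p. 190] [cite: GelbartRogawski1991, §3.1 (3.1.3), p. 456] -/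
theorem exists_smul_unitVec_of_implements_of_darbouxMatrix_mem (γ : LocalSp F N T v)
    (hγ : ∀ i j, darbouxMatrix (localGram F N T v) (isUnit_det_localGram F N T hTd v) γ.1 i j ∈ v.adicCompletionIntegers F)
    (h2 : (⅟(2 : v.adicCompletion F) : v.adicCompletion F) ∈ v.adicCompletionIntegers F)
    (hcond : ((adeleAddChar F).adicComponent v).HasConductorExp 0)
    {M : SchwartzBruhat (Fin N → v.adicCompletion F) ≃ₗ[ℂ] SchwartzBruhat (Fin N → v.adicCompletion F)}
    (hM : Implements (localSchrodinger F N T v) (ofSymplectic _ γ) M) :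
    ∃ c : ℂˣ, M (unitVec F (Fin N) v) = (c : ℂ) • unitVec F (Fin N) v := by
  letI : MeasurableSpace (v.adicCompletion F) := borel _
  haveI : BorelSpace (v.adicCompletion F) := ⟨rfl⟩
  have hb : ∀ y : Fin N → v.adicCompletion F, Continuous fun u : Fin N → v.adicCompletion F =>
      dotProductBilin (v.adicCompletion F) (v.adicCompletion F) u y := fun y => by
    simp only [dotProductBilin_apply_apply, dotProduct]
    exact continuous_finsetSum _ fun i _ => (continuous_apply i).mul continuous_const
  have hbT : ∀ y : Fin N → v.adicCompletion F, Continuous fun u : Fin N → v.adicCompletion F =>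
      localPairing F N T v u y := fun y => by
    simp only [Matrix.toLinearMap₂'_apply', dotProduct]
    exact continuous_finsetSum _ fun i _ => (continuous_apply i).mul continuous_const
  -- the Darboux matrix of `γ` lifts to `Sp_{2N}(𝒪_v)`
  obtain ⟨A, hA⟩ := exists_mapHom_subtype_eq F N v
    ⟨darbouxMatrix (localGram F N T v) (isUnit_det_localGram F N T hTd v) γ.1,
      darbouxMatrix_mem_symplecticGroup (localGram F N T v) (isUnit_det_localGram F N T hTd v) γ⟩ hγ
  have himp : Implements (localSchrodinger F N T v) (ofSymplectic _
      (SymplecticMatrix.transportSp (localGram F N T v) (isUnit_det_localGram F N T hTd v)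
        (SymplecticMatrix.mapHom (v.adicCompletionIntegers F).subtype A))) M := by
    rw [hA, transportSp_darbouxMatrix F N T hTd v γ]; exact hM
  exact exists_smul_integersIndicator_of_implements (localGram F N T v) (isUnit_det_localGram F N T hTd v)
    (isLocallyConstant_of_isContinuousNontrivial (isContinuousNontrivial_adeleAddCharAt F v)) hbT
    (v.adicCompletionIntegers F).subtype (fun r => (mem_primePowBall_zero_iff (r : v.adicCompletion F)).2 r.2)
    (unitVec F (Fin N) v) (coe_unitVec_eq_indicator_piPrimePowBall F N v) hb Measure.addHaar
    (isContinuousNontrivial_adeleAddCharAt F v) hcond ((mem_primePowBall_zero_iff _).2 h2)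
    (implementerUniqueUpToScalar_localSchrodinger F N T hTd v) A himp

/-- **a criterion for Darboux-integrality**: if `𝕋_v` and `𝕋_v⁻¹` are `v`-integral and the automorphism `g` of `𝕎_v` maps pairs of
`v`-integral vectors to pairs of `v`-integral vectors, then the Darboux matrix of `g` is `v`-integral (its `j`-th column is
`(a, 𝕋_v b')` for `(a, b') = g (e_j|₁, 𝕋_v⁻¹ e_j|₂)`). [cite: Weil1964, Chap. III n° 37 p. 188] -/
theorem darbouxMatrix_mem_of_forall (hTint : ∀ i j, localGram F N T v i j ∈ v.adicCompletionIntegers F)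
    (hTinv : ∀ i j, (localGram F N T v)⁻¹ i j ∈ v.adicCompletionIntegers F)
    (g : ((Fin N → v.adicCompletion F) × (Fin N → v.adicCompletion F)) ≃ₗ[v.adicCompletion F]
      ((Fin N → v.adicCompletion F) × (Fin N → v.adicCompletion F)))
    (hg : ∀ a b : Fin N → v.adicCompletion F, (∀ i, a i ∈ v.adicCompletionIntegers F) →
      (∀ i, b i ∈ v.adicCompletionIntegers F) →
        (∀ i, (g (a, b)).1 i ∈ v.adicCompletionIntegers F) ∧ ∀ i, (g (a, b)).2 i ∈ v.adicCompletionIntegers F)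
    (i j : Fin N ⊕ Fin N) :
    darbouxMatrix (localGram F N T v) (isUnit_det_localGram F N T hTd v) g i j ∈ v.adicCompletionIntegers F := by
  have hcol : darbouxMatrix (localGram F N T v) (isUnit_det_localGram F N T hTd v) g i j =
      (darbouxMatrix (localGram F N T v) (isUnit_det_localGram F N T hTd v) g *ᵥ Pi.single j 1) i := by
    rw [Matrix.mulVec_single_one, Matrix.col_apply]
  have hu : ∀ k, (Pi.single j (1 : v.adicCompletion F) : Fin N ⊕ Fin N → v.adicCompletion F) k ∈
      v.adicCompletionIntegers F := fun k => by
    by_cases hk : k = j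
    · subst hk; rw [Pi.single_eq_same]; exact one_mem _
    · rw [Pi.single_eq_of_ne hk]; exact zero_mem _
  rw [hcol, darbouxMatrix_mulVec, SymplecticMatrix.darboux_symm_apply, SymplecticMatrix.darboux_apply]
  obtain ⟨h1, h2⟩ := hg (Pi.single j (1 : v.adicCompletion F) ∘ Sum.inl)
    ((localGram F N T v)⁻¹ *ᵥ (Pi.single j (1 : v.adicCompletion F) ∘ Sum.inr)) (fun k => hu (Sum.inl k))
    (mulVec_mem_adicCompletionIntegers F v _ hTinv _ fun k => hu (Sum.inr k))
  rcases i with i | i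
  · rw [Sum.elim_inl]; exact h1 i
  · rw [Sum.elim_inr]; exact mulVec_mem_adicCompletionIntegers F v _ hTint _ h2 i

include hTd in
/-- `(𝕋_v)⁻¹ = (T⁻¹) ⊗ F_v` (so it is `v`-integral at almost every place, `T⁻¹` being rational).
[cite: CasselsFrohlichANT1967, Ch. II §14] -/
theorem localGram_inv : (localGram F N T v)⁻¹ = localGram F N T⁻¹ v := by
  apply Matrix.inv_eq_right_inv
  change (T.map (algebraMap F (v.adicCompletion F))) * (T⁻¹.map (algebraMap F (v.adicCompletion F))) = 1
  rw [← Matrix.map_mul, Matrix.mul_nonsing_inv T hTd, Matrix.map_one _ (map_zero _) (map_one _)]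

include hTd in
/-- for almost all `v`, `𝕋_v` and `𝕋_v⁻¹` are `v`-integral. [cite: CasselsFrohlichANT1967, Ch. II §14] -/
theorem eventually_localGram_and_inv_mem :
    ∀ᶠ v : HeightOneSpectrum (𝓞 F) in cofinite,
      (∀ i j, localGram F N T v i j ∈ v.adicCompletionIntegers F) ∧
        ∀ i j, (localGram F N T v)⁻¹ i j ∈ v.adicCompletionIntegers F := by
  filter_upwards [eventually_forall_entry_mem F T, eventually_forall_entry_mem F T⁻¹] with v hT hTi
  refine ⟨fun i j => hT i j, fun i j => ?_⟩
  rw [localGram_inv F N T hTd v]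
  exact hTi i j

end Generic

/-! ## §2 The Darboux matrix of the line transport `γ_x` and the eigenvector property of `M_x` -/

section LineTransport

variable {F : Type} [Field F] [NumberField F] (E : Type) [Field E] [NumberField E] [Algebra F E]
  [Algebra.IsQuadraticExtension F E] (v : HeightOneSpectrum (𝓞 F)) (c : E ≃ₐ[F] E) (N : ℕ)
  {δ₁ δ₂ : E} (hcδ₁ : c δ₁ = -δ₁) (hδ₁ : δ₁ ≠ 0) {d₁ : F} (hd₁ : δ₁ * δ₁ = algebraMap F E d₁)
  (hcδ₂ : c δ₂ = -δ₂) (hδ₂ : δ₂ ≠ 0) {d₂ : F} (hd₂ : δ₂ * δ₂ = algebraMap F E d₂) (x : (LocalRing E v)ˣ)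
  {p q s : v.adicCompletion F}
  (hxpq : (x : LocalRing E v) = toLocalRing E v p + toLocalRing E v q * algebraMap E (LocalRing E v) δ₁)
  (hs : algebraMap E (LocalRing E v) δ₁ = toLocalRing E v s * algebraMap E (LocalRing E v) δ₂)

omit [Algebra.IsQuadraticExtension F E] in
include hd₁ hxpq hs in
/-- **multiplication by `x` from `δ₁`- to `δ₂`-coordinates**: for `x = ι_v p + ι_v q · δ₁` and `δ₁ = ι_v s · δ₂`,
`x · (ι_v a + ι_v b · δ₁) = ι_v (p a + d₁ q b) + ι_v ((p b + q a) s) · δ₂`. [cite: MoeglinVignerasWaldspurger1987, Chap. 3 I.1] -/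
theorem mul_coords_lineTransport (a b : v.adicCompletion F) :
    (x : LocalRing E v) * (toLocalRing E v a + toLocalRing E v b * algebraMap E (LocalRing E v) δ₁) =
      toLocalRing E v (p * a + (d₁ : v.adicCompletion F) * (q * b)) +
        toLocalRing E v ((p * b + q * a) * s) * algebraMap E (LocalRing E v) δ₂ := by
  have hδ : algebraMap E (LocalRing E v) δ₁ * algebraMap E (LocalRing E v) δ₁ = toLocalRing E v (d₁ : v.adicCompletion F) := by
    rw [← map_mul, hd₁, toLocalRing_coe]
  rw [hxpq]
  simp only [map_add, map_mul]
  linear_combination (toLocalRing E v p * toLocalRing E v b + toLocalRing E v q * toLocalRing E v a) * hs +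
    (toLocalRing E v q * toLocalRing E v b) * hδ

include hxpq hs in
/-- **the symplectic transport in coordinates**: `γ_x (a, b) = (p a + d₁ q b, (q a + p b) s)` (coordinatewise on `F_vᴺ × F_vᴺ`).
[cite: MoeglinVignerasWaldspurger1987, Chap. 3 I.1–I.3] -/
theorem transport_apply_of_coords (a b : Fin N → v.adicCompletion F) :
    LineTransport.transport E v c N hcδ₁ hδ₁ hd₁ hcδ₂ hδ₂ hd₂ x (a, b) =
      (fun i => p * a i + (d₁ : v.adicCompletion F) * (q * b i), fun i => (p * b i + q * a i) * s) := by
  have h₁ := isQuadraticCoordinates_local E v c hcδ₁ hδ₁ hd₁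
  have h₂ := isQuadraticCoordinates_local E v c hcδ₂ hδ₂ hd₂
  have hab : (a, b) = QuadraticCoordinates.reIm (quadraticLocalEquiv E v c hcδ₁ hδ₁).toLinearEquiv.toAddEquiv (Fin N)
      ((QuadraticCoordinates.reIm (quadraticLocalEquiv E v c hcδ₁ hδ₁).toLinearEquiv.toAddEquiv (Fin N)).symm (a, b)) :=
    ((QuadraticCoordinates.reIm _ (Fin N)).apply_symm_apply (a, b)).symm
  rw [hab, LineTransport.transport_reIm]
  refine Prod.ext (funext fun i => ?_) (funext fun i => ?_)
  · rw [QuadraticCoordinates.reIm_apply_fst, LineTransport.mulL_apply, QuadraticCoordinates.reIm_symm_apply, h₁.apply,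
      mul_coords_lineTransport E v hd₁ x hxpq hs, h₂.re_eq]
  · rw [QuadraticCoordinates.reIm_apply_snd, LineTransport.mulL_apply, QuadraticCoordinates.reIm_symm_apply, h₁.apply,
      mul_coords_lineTransport E v hd₁ x hxpq hs, h₂.im_eq]

include hxpq hs in
/-- **the Darboux matrix of `γ_x` is `v`-integral** when `p, q, d₁, s, 𝕋_v, 𝕋_v⁻¹` are (it is the block matrix
`(p, d₁ q 𝕋_v⁻¹; s q 𝕋_v, s p)`). [cite: Weil1964, Chap. III n° 37 p. 188] [cite: MoeglinVignerasWaldspurger1987, Chap. 3 I.1–I.3] -/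
theorem darbouxMatrix_transport_mem (T : Matrix (Fin N) (Fin N) F) (hTd : IsUnit T.det)
    (hp : p ∈ v.adicCompletionIntegers F) (hq : q ∈ v.adicCompletionIntegers F)
    (hd : (d₁ : v.adicCompletion F) ∈ v.adicCompletionIntegers F) (hsv : s ∈ v.adicCompletionIntegers F)
    (hTint : ∀ i j, localGram F N T v i j ∈ v.adicCompletionIntegers F)
    (hTinv : ∀ i j, (localGram F N T v)⁻¹ i j ∈ v.adicCompletionIntegers F) (i j : Fin N ⊕ Fin N) :
    darbouxMatrix (localGram F N T v) (isUnit_det_localGram F N T hTd v)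
      (LineTransport.transport E v c N hcδ₁ hδ₁ hd₁ hcδ₂ hδ₂ hd₂ x) i j ∈ v.adicCompletionIntegers F := by
  refine darbouxMatrix_mem_of_forall F N T hTd v hTint hTinv _ (fun a b ha hb => ?_) i j
  rw [transport_apply_of_coords E v c N hcδ₁ hδ₁ hd₁ hcδ₂ hδ₂ hd₂ x hxpq hs]
  exact ⟨fun k => add_mem (mul_mem hp (ha k)) (mul_mem hd (mul_mem hq (hb k))),
    fun k => mul_mem (add_mem (mul_mem hp (hb k)) (mul_mem hq (ha k))) hsv⟩

include hxpq hs in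
/-- **THE LINE-TRANSPORT OPERATOR FIXES THE LINE OF `1_{𝒪_vᴺ}` AT A GOOD PLACE**: if `x = ι_v p + ι_v q · δ₁` with
`δ₁ = ι_v s · δ₂` and `p, q, d₁, s, 𝕋_v, 𝕋_v⁻¹` all `v`-integral, `2 ∈ 𝒪_v^×`, `ψ_v` of conductor `𝒪_v`, then the operator
`M_x = lineTransportOp … x …` of the chosen lift `q_x = (γ_x, M_x)` satisfies `M_x 1_{𝒪_vᴺ} = c · 1_{𝒪_vᴺ}`, `c ∈ ℂˣ` (it
implements the Darboux-integral `γ_x`). [cite: MoeglinVignerasWaldspurger1987, Chap. 2 II.1 (A), II.10]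
[cite: Weil1964, Chap. III n° 38 p. 190] [cite: GelbartRogawski1991, §3.1 (3.1.3), p. 456] -/
theorem exists_smul_unitVec_lineTransportOp (T : Matrix (Fin N) (Fin N) F) (hT : T.IsSymm) (hTd : IsUnit T.det)
    (hx : algebraMap E (LocalRing E v) δ₂ = (x : LocalRing E v) * conjLocal E c v x * algebraMap E (LocalRing E v) δ₁)
    (hp : p ∈ v.adicCompletionIntegers F) (hq : q ∈ v.adicCompletionIntegers F)
    (hd : (d₁ : v.adicCompletion F) ∈ v.adicCompletionIntegers F) (hsv : s ∈ v.adicCompletionIntegers F)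
    (hTint : ∀ i j, localGram F N T v i j ∈ v.adicCompletionIntegers F)
    (hTinv : ∀ i j, (localGram F N T v)⁻¹ i j ∈ v.adicCompletionIntegers F)
    (h2 : (⅟(2 : v.adicCompletion F) : v.adicCompletion F) ∈ v.adicCompletionIntegers F)
    (hcond : ((adeleAddChar F).adicComponent v).HasConductorExp 0) :
    ∃ c' : ℂˣ, _root_.Literature.RepresentationTheory.MoeglinVignerasWaldspurger1987.lineTransportOp E v c N hcδ₁ hδ₁ hd₁ hcδ₂ hδ₂ hd₂ x T hT hTd hx
        (unitVec F (Fin N) v) =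
      (c' : ℂ) • unitVec F (Fin N) v := by
  refine exists_smul_unitVec_of_implements_of_darbouxMatrix_mem F N T hTd v
    (LineTransport.transportSp E v c N hcδ₁ hδ₁ hd₁ hcδ₂ hδ₂ hd₂ x T hT hx)
    (darbouxMatrix_transport_mem E v c N hcδ₁ hδ₁ hd₁ hcδ₂ hδ₂ hd₂ x hxpq hs T hTd hp hq hd hsv hTint hTinv) h2 hcond ?_
  rw [← proj_lineTransportLift E v c N hcδ₁ hδ₁ hd₁ hcδ₂ hδ₂ hd₂ x T hT hTd hx]
  exact MpPsi.toRep_implements _ _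

end LineTransport

/-! ## §3 Almost every place: the family of (P′1) in the `hx` currency of S6a -/

section Family

variable {F : Type} [Field F] [NumberField F] (E : Type) [Field E] [NumberField E] [Algebra F E]
  [Algebra.IsQuadraticExtension F E] (c : E ≃ₐ[F] E) (N : ℕ)
  {δ : E} (hcδ : c δ = -δ) (hδ : δ ≠ 0) {d : F} (hd : δ * δ = algebraMap F E d)

include hd in
/-- **LOCAL UNITS OF THE LINE TRANSPORT WITH THE UNRAMIFIED EIGENVECTOR PROPERTY ALMOST EVERYWHERE**: for `a₁, a₂ ∈ F^×` of the
same local norm class in `F_v^× ⧸ N(F_v[√d]^×)` at every finite `v` there are units `x_v ∈ (E ⊗_F F_v)^×` with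
`a₂⁻¹δ = x_v x̄_v a₁⁻¹δ` at EVERY finite place (the `hx` of ★ S6a `lineTransportSplitting_lineTransportSection_congrW_undoubledSplittings_holds`)
such that at ALMOST EVERY finite place `1_{𝒪_vᴺ} = c · M_{x_v} 1_{𝒪_vᴺ}`, `c ∈ ℂˣ`, for the line-transport operator
`M_{x_v} = lineTransportOp … (x v) …` on `𝒮(F_vᴺ)` — the `hc` binder of ★ `IsRestrictedTensorProductRep.exists_equiv_of_forall_equiv` (`x_v = ι_v p_v + ι_v (q_v a₁) · a₁⁻¹δ` for a finite-adèle solution of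
`p² − d q² = a₂⁻¹a₁`, ★ `exists_finiteAdele_sq_sub_mul_sq_eq`; `p_v, q_v a₁, a₁⁻²d, s = a₁⁻¹a₂, 𝕋_v, 𝕋_v⁻¹` integral a.e.).
[cite: Weil1964, Chap. III n° 38 p. 190] [cite: MoeglinVignerasWaldspurger1987, Chap. 2 II.10]
[cite: GelbartRogawski1991, §3.1 (3.1.3), p. 456] [cite: Omeara1963, §65A Example 65:2] -/
theorem exists_localRing_units_lineDelta_eventually_smul_unitVec (T : Matrix (Fin N) (Fin N) F) (hT : T.IsSymm)
    (hTd : IsUnit T.det) (a₁ a₂ : Fˣ)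
    (h : ∀ v : HeightOneSpectrum (𝓞 F),
      (Units.map (algebraMap F (v.adicCompletion F)).toMonoidHom a₁ :
          (v.adicCompletion F)ˣ ⧸ QuadraticForms.quadraticNormSubgroup (v.adicCompletion F) (algebraMap F (v.adicCompletion F) d)) =
        (Units.map (algebraMap F (v.adicCompletion F)).toMonoidHom a₂ :
          (v.adicCompletion F)ˣ ⧸ QuadraticForms.quadraticNormSubgroup (v.adicCompletion F) (algebraMap F (v.adicCompletion F) d))) :
    ∃ (x : ∀ v : HeightOneSpectrum (𝓞 F), (LocalRing E v)ˣ)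
      (hx : ∀ v, algebraMap E (LocalRing E v) (algebraMap F E (↑a₂⁻¹ : F) * δ) =
        (x v : LocalRing E v) * conjLocal E c v (x v) * algebraMap E (LocalRing E v) (algebraMap F E (↑a₁⁻¹ : F) * δ)),
      ∀ᶠ v in cofinite, ∃ c' : ℂˣ, unitVec F (Fin N) v =
        c' • _root_.Literature.RepresentationTheory.MoeglinVignerasWaldspurger1987.lineTransportOp E v c N
          (conj_lineDelta hcδ a₁) (lineDelta_ne_zero hδ a₁) (lineDelta_mul_self hd a₁) (conj_lineDelta hcδ a₂)
          (lineDelta_ne_zero hδ a₂) (lineDelta_mul_self hd a₂) (x v) T hT hTd (hx v) (unitVec F (Fin N) v) := by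
  have hd0 : d ≠ 0 := fun h0 => hδ (by rwa [h0, map_zero, mul_self_eq_zero] at hd)
  -- `t := a₂⁻¹ a₁` is a local norm everywhere; a finite-adèle solution of `p² − d q² = t`
  set t : Fˣ := a₂⁻¹ * a₁ with ht_def
  have ht : ∀ v : HeightOneSpectrum (𝓞 F),
      Units.map (algebraMap F (v.adicCompletion F)).toMonoidHom t ∈
        QuadraticForms.quadraticNormSubgroup (v.adicCompletion F) (algebraMap F (v.adicCompletion F) d) := fun v => by
    rw [ht_def, map_mul, map_inv]
    exact QuotientGroup.eq.1 (h v).symm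
  obtain ⟨pA, qA, hpq⟩ := QuadraticForms.exists_finiteAdele_sq_sub_mul_sq_eq (K := F) hd0 t ht
  have hv : ∀ v : HeightOneSpectrum (𝓞 F),
      (pA v) ^ 2 - algebraMap F (v.adicCompletion F) d * (qA v) ^ 2 = algebraMap F (v.adicCompletion F) (t : F) := fun v => by
    have := congrArg (fun z : FiniteAdeleRing (𝓞 F) F => z v) hpq
    exact this
  -- the local elements `X_v := ι_v p_v + ι_v (q_v a₁) · (a₁⁻¹δ)` and their norms
  have h₁ : ∀ v : HeightOneSpectrum (𝓞 F), IsQuadraticCoordinates (toLocalRing E v)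
      (quadraticLocalEquiv E v c (conj_lineDelta hcδ a₁) (lineDelta_ne_zero hδ a₁)).toLinearEquiv.toAddEquiv
      (algebraMap E (LocalRing E v) (algebraMap F E (↑a₁⁻¹ : F) * δ))
      (algebraMap F (v.adicCompletion F) (↑a₁⁻¹ * ↑a₁⁻¹ * d : F)) :=
    fun v => isQuadraticCoordinates_local E v c (conj_lineDelta hcδ a₁) (lineDelta_ne_zero hδ a₁) (lineDelta_mul_self hd a₁)
  set X : ∀ v : HeightOneSpectrum (𝓞 F), LocalRing E v := fun v =>
    toLocalRing E v (pA v) + toLocalRing E v (qA v * algebraMap F (v.adicCompletion F) (a₁ : F)) *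
      algebraMap E (LocalRing E v) (algebraMap F E (↑a₁⁻¹ : F) * δ) with hXdef
  have hconj : ∀ v, conjLocal E c v (X v) = toLocalRing E v (pA v) +
      toLocalRing E v (-(qA v * algebraMap F (v.adicCompletion F) (a₁ : F))) *
        algebraMap E (LocalRing E v) (algebraMap F E (↑a₁⁻¹ : F) * δ) := fun v => by
    show conjLocal E c v (toLocalRing E v (pA v) + toLocalRing E v (qA v * algebraMap F (v.adicCompletion F) (a₁ : F)) *
      algebraMap E (LocalRing E v) (algebraMap F E (↑a₁⁻¹ : F) * δ)) = _
    rw [map_add, map_mul, conjLocal_toLocalRing, conjLocal_toLocalRing, conjLocal_algebraMap, conj_lineDelta hcδ a₁, map_neg,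
      map_neg]
    ring
  have ha : ∀ v : HeightOneSpectrum (𝓞 F),
      algebraMap F (v.adicCompletion F) (a₁ : F) * algebraMap F (v.adicCompletion F) (↑a₁⁻¹ : F) = 1 := fun v => by
    rw [← map_mul, Units.mul_inv, map_one]
  have hN : ∀ v, X v * conjLocal E c v (X v) = toLocalRing E v (algebraMap F (v.adicCompletion F) (t : F)) := fun v => by
    rw [hconj]
    show (toLocalRing E v (pA v) + toLocalRing E v (qA v * algebraMap F (v.adicCompletion F) (a₁ : F)) *
        algebraMap E (LocalRing E v) (algebraMap F E (↑a₁⁻¹ : F) * δ)) *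
      (toLocalRing E v (pA v) + toLocalRing E v (-(qA v * algebraMap F (v.adicCompletion F) (a₁ : F))) *
        algebraMap E (LocalRing E v) (algebraMap F E (↑a₁⁻¹ : F) * δ)) = _
    rw [(h₁ v).mul_formula]
    have e : pA v * -(qA v * algebraMap F (v.adicCompletion F) (a₁ : F)) +
        qA v * algebraMap F (v.adicCompletion F) (a₁ : F) * pA v = 0 := by ring
    rw [e, map_zero, zero_mul, add_zero]
    congr 1
    rw [map_mul, map_mul]
    linear_combination (hv v) + (-(algebraMap F (v.adicCompletion F) d * (qA v) ^ 2 *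
      (1 + algebraMap F (v.adicCompletion F) (a₁ : F) * algebraMap F (v.adicCompletion F) (↑a₁⁻¹ : F)))) * ha v
  have ht0 : ∀ v : HeightOneSpectrum (𝓞 F), algebraMap F (v.adicCompletion F) (t : F) ≠ 0 := fun v h0 =>
    t.ne_zero ((algebraMap F (v.adicCompletion F)).injective (h0.trans (map_zero _).symm))
  have hXu : ∀ v, IsUnit (X v) := fun v =>
    isUnit_of_mul_isUnit_left ((hN v).symm ▸ ((IsUnit.mk0 _ (ht0 v)).map (toLocalRing E v)))
  -- the `hx` shape: `a₂⁻¹δ = (a₂⁻¹a₁) · a₁⁻¹δ = X X̄ · a₁⁻¹δ`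
  have hx : ∀ v, algebraMap E (LocalRing E v) (algebraMap F E (↑a₂⁻¹ : F) * δ) =
      ((hXu v).unit : LocalRing E v) * conjLocal E c v ((hXu v).unit) *
        algebraMap E (LocalRing E v) (algebraMap F E (↑a₁⁻¹ : F) * δ) := fun v => by
    have e1 : algebraMap F E (↑a₂⁻¹ : F) * δ = algebraMap F E ((t : Fˣ) : F) * (algebraMap F E (↑a₁⁻¹ : F) * δ) := by
      rw [ht_def, Units.val_mul, map_mul, ← mul_assoc, mul_assoc (algebraMap F E (↑a₂⁻¹ : F)), ← map_mul, Units.mul_inv,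
        map_one, mul_one]
    have e3 : toLocalRing E v (algebraMap F (v.adicCompletion F) ((t : Fˣ) : F)) =
        algebraMap E (LocalRing E v) (algebraMap F E ((t : Fˣ) : F)) := toLocalRing_coe E v _
    rw [IsUnit.unit_spec, e1, map_mul, hN, e3]
  -- `δ₁ = s δ₂` with `s = a₁⁻¹ a₂ = t⁻¹`, a global unit
  have hs_units : (a₁⁻¹ : Fˣ) = t⁻¹ * a₂⁻¹ := by
    rw [ht_def, _root_.mul_inv_rev, inv_inv, mul_inv_cancel_right]
  have hs : ∀ v : HeightOneSpectrum (𝓞 F), algebraMap E (LocalRing E v) (algebraMap F E (↑a₁⁻¹ : F) * δ) =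
      toLocalRing E v (algebraMap F (v.adicCompletion F) ((t⁻¹ : Fˣ) : F)) *
        algebraMap E (LocalRing E v) (algebraMap F E (↑a₂⁻¹ : F) * δ) := fun v => by
    have e2 : toLocalRing E v (algebraMap F (v.adicCompletion F) ((t⁻¹ : Fˣ) : F)) =
        algebraMap E (LocalRing E v) (algebraMap F E ((t⁻¹ : Fˣ) : F)) := toLocalRing_coe E v _
    rw [e2, ← map_mul, ← mul_assoc, ← map_mul, ← Units.val_mul, ← hs_units]
  refine ⟨fun v => (hXu v).unit, hx, ?_⟩
  -- almost every place
  filter_upwards [pA.2, qA.2, eventually_algebraMap_mem_adicCompletionIntegers F (a₁ : F),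
    eventually_algebraMap_mem_adicCompletionIntegers F (↑a₁⁻¹ * ↑a₁⁻¹ * d : F),
    eventually_algebraMap_mem_adicCompletionIntegers F ((t⁻¹ : Fˣ) : F), eventually_localGram_and_inv_mem F N T hTd,
    eventually_invOf_two_mem F, eventually_hasConductorExp_zero_adicComponent_adeleAddChar (K := F)]
    with v hpv hqv hav hdv hsv hTv h2 hcond
  obtain ⟨c', hc'⟩ := exists_smul_unitVec_lineTransportOp E v c N (conj_lineDelta hcδ a₁) (lineDelta_ne_zero hδ a₁)
    (lineDelta_mul_self hd a₁) (conj_lineDelta hcδ a₂) (lineDelta_ne_zero hδ a₂) (lineDelta_mul_self hd a₂) (hXu v).unit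
    (p := pA v) (q := qA v * algebraMap F (v.adicCompletion F) (a₁ : F))
    (s := algebraMap F (v.adicCompletion F) ((t⁻¹ : Fˣ) : F))
    (hXu v).unit_spec (hs v) T hT hTd (hx v) hpv (mul_mem hqv hav) hdv hsv hTv.1 hTv.2 h2 hcond
  exact ⟨c'⁻¹, by rw [Units.smul_def, hc', smul_smul, Units.inv_mul, one_smul]⟩

end Family

end Literature.NumberTheory.GelbartRogawski1991.UnitaryDualPair.LocalSplitting

end
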